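import Literature.Topology.FourManifolds.PageSystemTopology
import Literature.Topology.FourManifolds.CollarTheoremGeneral
import HarnessLib

/-!
# The binding of an open book trivialised by a page with connected boundary is connected

Topic `Literature/Topology/FourManifolds`; proof file (theorems only, no definitions, no named
facts), layer 2 of the proof of the dictionary sub-lemma (E-d)
`IsPageSystem.finrank_singularHomology_one_eq_bettiNumber` (`PageSystemBetti.lean`), after the
trivialisation `int P × (ℝ/ℤ) ≃ₜ M ∖ B` (`IsPageSystem.exists_homeomorph`, `PageSystemTopology.lean`).
Etnyre–Fuller 2006, §2 / J. B. Etnyre, *Lectures on open book decompositions and contact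
structures* (2006), §2: the binding of the open book with page `P` is `∂P`; in the tree's
vocabulary (`IsPageSystem ob J`, `AchiralLefschetzModel.lean`, where `J` is unconstrained on
`∂P × ℝ`) what survives is: **if `∂P` is connected and `P` is compact, the binding is connected**,
hence a single circle.

* `IsPageSystem.exists_apply_zero_eq_tube`, `IsPageSystem.eventually_forall_apply_eq_tube_notMem` —
  every binding point `tube i (x, 0)` is the limit of the page points `tube i (x, r e₀) = J (q_r, 0)`
  (`r → 0⁺`, normal form of `ob.proj` in the tube), and the page coordinates `q_r` leave every
  compact part of `int P` (the compact `J (C × [0, 1]) ⊆ M ∖ B` misses the binding point).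
* `IsPageSystem.exists_isCompact_forall_apply_mem` — a compact `K ⊆ M ∖ B` is seen in a compact
  part of `int P` (first projection of `Φ⁻¹(K)`, `Φ` the trivialisation).
* `exists_isPreconnected_end` — **the end of the interior of a compact surface with connected
  boundary is connected**: beyond any compact `C ⊆ int P` lies the punctured collar
  `c(∂P × (0, t))` (collar theorem `BoundaryData.nonempty_collar_holds`, tube lemma over the
  compact `∂P`), which is connected and swallows `N ∩ int P` for the open collar `N ⊇ ∂P`.
* `IsPageSystem.isPreconnected_binding` — the theorem: two open sets separating `B` would both
  have to contain page images `J (q, 0)`, `q` in one connected end.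
* `OpenBook.binding_eq_range_core_of_isPreconnected` — a connected binding is the core of any
  of its tubes (each core is clopen in `B`).

## References

* J. B. Etnyre, T. Fuller, *Realizing 4-manifolds as achiral Lefschetz fibrations*, IMRN 2006, §2.
  [EtnyreFuller2006]
* J. M. Lee, *Introduction to Smooth Manifolds*, 2nd ed. (2013), Thm. 9.25 (collars).
  [LeeSmoothManifolds2013]
-/

noncomputable section

open scoped Manifold ContDiff Topology
open Set Filter Function Topology

namespace Literature.Topology.FourManifolds

universe u v

section PageSystem

variable {P : Type v} [TopologicalSpace P] [ChartedSpace (EuclideanHalfSpace 2) P]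
  {M : Type u} [TopologicalSpace M] [ChartedSpace (EuclideanSpace ℝ (Fin 3)) M] [IsManifold (𝓡 3) ∞ M]
  {ob : Literature.Geometry.Symplectic.OpenBook M} {J : P × ℝ → M}

namespace IsPageSystem

/-! ### Page points near the binding, and compact parts of `M ∖ B` -/

/-- **Every binding point is a limit of points of the page of angle `0`**: for `r > 0` the tube
point `tube i (x, r e₀)`, `e₀ = circlePt 0`, is `J (q, 0)` for some `q ∈ int P` (normal form
`proj (tube i (x, w)) = w/‖w‖`, periodicity of `J`). [cite: EtnyreFuller2006, §2] -/
theorem exists_apply_zero_eq_tube (hJ : IsPageSystem ob J) (i : Fin ob.k)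
    (x : Metric.sphere (0 : EuclideanSpace ℝ (Fin 2)) 1) {r : ℝ} (hr : 0 < r) :
    ∃ q ∈ (𝓡∂ 2).interior P, J (q, 0) = ob.tube i (x, r • ((circlePt 0).1 : EuclideanSpace ℝ (Fin 2))) := by
  set w : EuclideanSpace ℝ (Fin 2) := r • ((circlePt 0).1 : EuclideanSpace ℝ (Fin 2)) with hw
  have hnorm : ‖w‖ = r := by
    rw [hw, norm_smul, norm_eq_of_mem_sphere, mul_one, Real.norm_of_nonneg hr.le]
  have hw0 : w ≠ 0 := by
    rw [← norm_ne_zero_iff, hnorm]; exact hr.ne'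
  have hmem : ob.tube i (x, w) ∈ ob.page (circlePt 0) :=
    ob.tube_mem_page i x hw0 _ (by rw [hnorm, hw, smul_smul, inv_mul_cancel₀ hr.ne', one_smul])
  obtain ⟨q, hq, θ, hθ⟩ := hJ.exists_eq _ hmem.1
  have hc : circlePt θ = circlePt 0 := by
    rw [← hJ.proj_apply hq θ, hθ]; exact hmem.2
  obtain ⟨m, hm⟩ := circlePt_eq_circlePt_iff.1 hc
  refine ⟨q, hq, ?_⟩
  rw [← hθ, hm, hJ.apply_add_int hq 0 m]

/-- The tube points `tube i (x, r e₀)` tend to the binding point `tube i (x, 0)` as `r → 0`.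
[folklore] -/
theorem tendsto_tube_smul (i : Fin ob.k) (x : Metric.sphere (0 : EuclideanSpace ℝ (Fin 2)) 1) :
    Tendsto (fun r : ℝ => ob.tube i (x, r • ((circlePt 0).1 : EuclideanSpace ℝ (Fin 2)))) (𝓝 0)
      (𝓝 (ob.tube i (x, 0))) := by
  have hc : Continuous fun r : ℝ => ob.tube i (x, r • ((circlePt 0).1 : EuclideanSpace ℝ (Fin 2))) :=
    (ob.continuous_tube i).comp (by fun_prop)
  simpa using hc.tendsto 0

/-- The image `J (C × ℝ) = J (C × [0, 1])` of a compact part `C` of the interior is compact.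
[folklore] -/
theorem isCompact_image_prod (hJ : IsPageSystem ob J) {C : Set P} (hC : IsCompact C)
    (hCi : C ⊆ (𝓡∂ 2).interior P) : IsCompact (J '' C ×ˢ (Icc (0 : ℝ) 1)) :=
  (hC.prod isCompact_Icc).image_of_continuousOn
    (hJ.continuousOn.mono (prod_mono hCi (subset_univ _)))

/-- Every parametrised page point with page coordinate in `C` lies in `J (C × [0, 1])`
(periodicity). [folklore] -/
theorem apply_mem_image_prod (hJ : IsPageSystem ob J) {C : Set P} (hCi : C ⊆ (𝓡∂ 2).interior P)
    {q : P} (hq : q ∈ C) (θ : ℝ) : J (q, θ) ∈ J '' C ×ˢ (Icc (0 : ℝ) 1) := by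
  refine ⟨(q, Int.fract θ), ⟨hq, (Int.fract_nonneg θ), (Int.fract_lt_one θ).le⟩, ?_⟩
  conv_rhs => rw [← Int.fract_add_floor θ]
  exact (hJ.apply_add_int (hCi hq) _ _).symm

/-- **Page coordinates escape every compact part of the interior near the binding**: for a
compact `C ⊆ int P` and a binding point `tube i (x, 0)`, for all `r` near `0` no parametrised
page point `J (q, θ)`, `q ∈ C`, equals `tube i (x, r e₀)` (the compact set `J (C × [0, 1]) ⊆ M ∖ B`
is closed and misses the binding point). [cite: EtnyreFuller2006, §2] -/
theorem eventually_forall_apply_eq_tube_notMem [T2Space M] (hJ : IsPageSystem ob J) {C : Set P}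
    (hC : IsCompact C) (hCi : C ⊆ (𝓡∂ 2).interior P) (i : Fin ob.k)
    (x : Metric.sphere (0 : EuclideanSpace ℝ (Fin 2)) 1) :
    ∀ᶠ r : ℝ in 𝓝 0, ∀ q ∈ (𝓡∂ 2).interior P, ∀ θ : ℝ,
      J (q, θ) = ob.tube i (x, r • ((circlePt 0).1 : EuclideanSpace ℝ (Fin 2))) → q ∉ C := by
  have hK := hJ.isCompact_image_prod hC hCi
  have hb : ob.tube i (x, 0) ∉ J '' C ×ˢ (Icc (0 : ℝ) 1) := by
    rintro ⟨⟨q, θ⟩, ⟨hq, -⟩, h⟩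
    exact hJ.apply_notMem_binding (hCi hq) θ (h ▸ ob.core_mem_binding i x)
  have hev := (tendsto_tube_smul (ob := ob) i x).eventually_mem (hK.isClosed.isOpen_compl.mem_nhds hb)
  filter_upwards [hev] with r hr q hq θ hqθ hqC
  exact hr (hqθ ▸ hJ.apply_mem_image_prod hCi hqC θ)

/-- **Compact parts of `M ∖ B` come from compact parts of the interior**: for a compact
`K ⊆ M ∖ B` there is a compact `C ⊆ int P` containing the page coordinate of every parametrised
page point in `K` (the image of `Φ⁻¹(K)` under the first projection, `Φ` the trivialisation).
[cite: EtnyreFuller2006, §2] -/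
theorem exists_isCompact_forall_apply_mem [IsManifold (𝓡∂ 2) ∞ P] [T2Space M]
    (hJ : IsPageSystem ob J) {K : Set M} (hK : IsCompact K) (hKB : K ⊆ (ob.binding)ᶜ) :
    ∃ C : Set P, IsCompact C ∧ C ⊆ (𝓡∂ 2).interior P ∧
      ∀ q ∈ (𝓡∂ 2).interior P, ∀ θ : ℝ, J (q, θ) ∈ K → q ∈ C := by
  set K' : Set ↥(ob.binding)ᶜ := Subtype.val ⁻¹' K with hK'
  have hK'c : IsCompact K' := by
    rw [IsEmbedding.subtypeVal.isCompact_iff, hK', Subtype.image_preimage_coe,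
      inter_eq_right.2 hKB]
    exact hK
  obtain ⟨Φ, hΦ⟩ := hJ.exists_homeomorph
  set C' : Set ↥((𝓡∂ 2).interior P) := Prod.fst '' (Φ.symm '' K') with hC'
  have hC'c : IsCompact C' := (hK'c.image Φ.symm.continuous).image continuous_fst
  refine ⟨Subtype.val '' C', hC'c.image continuous_subtype_val, ?_, fun q hq θ hmem => ?_⟩
  · rintro _ ⟨q, -, rfl⟩
    exact q.2
  · have hΦq : Φ (⟨q, hq⟩, ((θ : ℝ) : AddCircle (1 : ℝ))) =
        ⟨J (q, θ), hJ.apply_notMem_binding hq θ⟩ :=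
      Subtype.ext (hΦ ⟨q, hq⟩ θ)
    refine ⟨⟨q, hq⟩, ⟨Φ.symm ⟨J (q, θ), hJ.apply_notMem_binding hq θ⟩,
      ⟨⟨J (q, θ), hJ.apply_notMem_binding hq θ⟩, hmem, rfl⟩, ?_⟩, rfl⟩
    rw [← hΦq, Homeomorph.symm_apply_apply]

/-! ### The end of the interior of a page with connected boundary -/

omit [ChartedSpace (EuclideanHalfSpace 2) P] in
/-- Images of low sub-collars are open: for a topological embedding `c` of `Z × [0, 1]` with open
image of `Z × [0, 1)`, the image of `Z × [0, t)` (`t ≤ 1`) is open. [folklore] -/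
theorem isOpen_image_collar_lt {Z : Type*} [TopologicalSpace Z]
    {c : Z × Icc (0 : ℝ) 1 → P} (hc : IsEmbedding c) (ho : IsOpen (c '' {p | (p.2 : ℝ) < 1}))
    {t : ℝ} (ht : t ≤ 1) : IsOpen (c '' {p | (p.2 : ℝ) < t}) := by
  have hW : IsOpen {p : Z × Icc (0 : ℝ) 1 | (p.2 : ℝ) < t} :=
    isOpen_lt (continuous_subtype_val.comp continuous_snd) continuous_const
  obtain ⟨O, hO, hOW⟩ := hc.isInducing.isOpen_iff.1 hW
  have heq : c '' {p | (p.2 : ℝ) < t} = O ∩ c '' {p | (p.2 : ℝ) < 1} := by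
    apply Subset.antisymm
    · rintro _ ⟨p, hp, rfl⟩
      have hpO : p ∈ c ⁻¹' O := by rw [hOW]; exact hp
      exact ⟨hpO, p, lt_of_lt_of_le hp ht, rfl⟩
    · rintro y ⟨hyO, p, hp1, rfl⟩
      have hpW : p ∈ {p : Z × Icc (0 : ℝ) 1 | (p.2 : ℝ) < t} := by rw [← hOW]; exact hyO
      exact ⟨p, hpW, rfl⟩
  rw [heq]
  exact hO.inter ho

omit [ChartedSpace (EuclideanHalfSpace 2) P] in
/-- **The connected end of the interior of a compact surface with connected boundary** (by the
collar theorem): for every compact `C ⊆ int P` there are a preconnected `E ⊆ int P ∖ C` and an open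
`N ⊇ ∂P` with `N ∩ int P ⊆ E` — namely the punctured collar `E = c(∂P × (0, t))` and the collar
`N = c(∂P × [0, t))` for small `t` (tube lemma over the compact `∂P`).
[cite: LeeSmoothManifolds2013, Thm. 9.25] -/
theorem exists_isPreconnected_end [T2Space P] [SecondCountableTopology P] [CompactSpace P]
    [ChartedSpace (EuclideanHalfSpace 2) P] [IsManifold (𝓡∂ 2) ∞ P]
    (hP : ConnectedSpace ↥((𝓡∂ 2).boundary P))
    {C : Set P} (hC : IsCompact C) (hCi : C ⊆ (𝓡∂ 2).interior P) :
    ∃ E N : Set P, IsPreconnected E ∧ E ⊆ (𝓡∂ 2).interior P ∧ Disjoint E C ∧ IsOpen N ∧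
      (𝓡∂ 2).boundary P ⊆ N ∧ N ∩ (𝓡∂ 2).interior P ⊆ E := by
  let b := BoundaryManifold.boundaryData 1 P
  obtain ⟨c⟩ := BoundaryData.nonempty_collar_holds 0 P b
  haveI : ConnectedSpace b.carrier := hP
  haveI : CompactSpace b.carrier := isCompact_iff_compactSpace.1
    ((𝓡∂ 2).isClosed_boundary (M := P) (n := ∞) (by simp)).isCompact
  -- the open set `c ⁻¹' Cᶜ` contains `∂P × {0}`; tube lemma
  have hV : IsOpen (c ⁻¹' Cᶜ) := hC.isClosed.isOpen_compl.preimage c.continuous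
  have hsub : (univ : Set b.carrier) ×ˢ ({⊥} : Set (Icc (0 : ℝ) 1)) ⊆ c ⁻¹' Cᶜ := by
    rintro ⟨z, s⟩ ⟨-, hs⟩
    rw [mem_singleton_iff] at hs
    subst hs
    rw [mem_preimage, c.apply_bot z]
    intro hzC
    exact (ModelWithCorners.disjoint_interior_boundary (I := 𝓡∂ 2) (M := P)).le_bot
      ⟨hCi hzC, b.incl_mem_boundary z⟩
  obtain ⟨u, v, -, hv, huniv, hbv, huv⟩ :=
    generalized_tube_lemma isCompact_univ isCompact_singleton hV hsub
  have hbv' : (⊥ : Icc (0 : ℝ) 1) ∈ v := hbv rfl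
  obtain ⟨ε, hε, hball⟩ := Metric.isOpen_iff.1 hv ⊥ hbv'
  set t : ℝ := min ε 1 with ht
  have ht0 : 0 < t := lt_min hε one_pos
  have ht1 : t ≤ 1 := min_le_right _ _
  have htε : t ≤ ε := min_le_left _ _
  -- points of height `< t` are mapped off `C`
  have hoff : ∀ (z : b.carrier) (s : Icc (0 : ℝ) 1), (s : ℝ) < t → c (z, s) ∉ C := by
    intro z s hs
    have hsv : s ∈ v := hball (by
      rw [Metric.mem_ball, Subtype.dist_eq, Icc.coe_bot, Real.dist_eq, sub_zero,
        abs_of_nonneg s.2.1]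
      exact lt_of_lt_of_le hs htε)
    exact huv ⟨huniv (mem_univ z), hsv⟩
  -- the punctured collar `E` and the collar `N`
  let g : b.carrier × ℝ → P := fun p => c (p.1, projIcc 0 1 zero_le_one p.2)
  have hg : Continuous g := c.continuous.comp (continuous_fst.prodMk (continuous_projIcc.comp continuous_snd))
  refine ⟨g '' (univ : Set b.carrier) ×ˢ Ioo 0 t, c '' {p | (p.2 : ℝ) < t},
    (isPreconnected_univ.prod isPreconnected_Ioo).image g hg.continuousOn, ?_, ?_,
    isOpen_image_collar_lt c.isSmoothEmbedding.isEmbedding c.isOpen_image ht1, ?_, ?_⟩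
  · -- `E ⊆ int P`
    rintro _ ⟨⟨z, s⟩, ⟨-, hs0, hst⟩, rfl⟩
    refine c.apply_mem_interior z ?_
    rw [← Subtype.coe_lt_coe, Icc.coe_bot, projIcc_of_mem zero_le_one ⟨hs0.le, (lt_of_lt_of_le hst ht1).le⟩]
    exact hs0
  · -- `E ∩ C = ∅`
    refine disjoint_left.2 ?_
    rintro _ ⟨⟨z, s⟩, ⟨-, hs0, hst⟩, rfl⟩
    refine hoff z _ ?_
    rw [projIcc_of_mem zero_le_one ⟨hs0.le, (lt_of_lt_of_le hst ht1).le⟩]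
    exact hst
  · -- `∂P ⊆ N`
    intro y hy
    obtain ⟨z, rfl⟩ : y ∈ range b.incl := by rw [b.range_incl]; exact hy
    refine ⟨(z, ⊥), ?_, c.apply_bot z⟩
    change ((⊥ : Icc (0 : ℝ) 1) : ℝ) < t
    rw [Icc.coe_bot]; exact ht0
  · -- `N ∩ int P ⊆ E`
    rintro y ⟨⟨⟨z, s⟩, hst, rfl⟩, hyi⟩
    have hs0 : 0 < (s : ℝ) := by
      rcases s.2.1.lt_or_eq with h | h
      · exact h
      · exfalso
        have hs : s = ⊥ := Subtype.ext (by rw [Icc.coe_bot]; exact h.symm)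
        rw [hs, c.apply_bot z] at hyi
        exact (ModelWithCorners.disjoint_interior_boundary (I := 𝓡∂ 2) (M := P)).le_bot
          ⟨hyi, b.incl_mem_boundary z⟩
    refine ⟨(z, (s : ℝ)), ⟨mem_univ _, hs0, hst⟩, ?_⟩
    change c (z, projIcc 0 1 zero_le_one (s : ℝ)) = c (z, s)
    rw [projIcc_val]

/-! ### The binding of a page with connected boundary is one circle -/

/-- **The binding of an open book trivialised by a page with connected boundary is connected**
(Etnyre–Fuller 2006, §2; Etnyre 2006, §2: the binding is `∂P`).  Proof: separate `B` by disjoint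
open sets `O₁`, `O₂`; the compact `K = M ∖ (O₁ ∪ O₂) ⊆ M ∖ B` is seen in a compact `C ⊆ int P`
(`exists_isCompact_forall_apply_mem`); the connected end `E` of `int P` beyond `C`
(`exists_isPreconnected_end`) has `J (E × 0) ⊆ O₁ ∪ O₂` connected, say `⊆ O₁`; but every binding
point is a limit of page points `J (q_r, 0)` with `q_r → ∂P`, i.e. `q_r ∈ E` eventually
(`exists_apply_zero_eq_tube`, `eventually_forall_apply_eq_tube_notMem`), so no binding point lies
in `O₂`. [cite: EtnyreFuller2006, §2] -/
theorem isPreconnected_binding [T2Space P] [SecondCountableTopology P] [CompactSpace P]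
    [IsManifold (𝓡∂ 2) ∞ P] (hP : ConnectedSpace ↥((𝓡∂ 2).boundary P))
    [T2Space M] [CompactSpace M] (hJ : IsPageSystem ob J) : IsPreconnected ob.binding := by
  rw [isPreconnected_iff_subset_of_fully_disjoint_closed ob.isClosed_binding]
  intro u v hu hv hcover hdisj
  obtain ⟨O₁, O₂, hO₁, hO₂, huO, hvO, hO⟩ := normal_separation hu hv hdisj
  -- the compact part of `M ∖ B` off `O₁ ∪ O₂`, seen in the interior of `P`
  have hK : IsCompact (O₁ ∪ O₂)ᶜ := (hO₁.union hO₂).isClosed_compl.isCompact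
  have hKB : (O₁ ∪ O₂)ᶜ ⊆ (ob.binding)ᶜ :=
    compl_subset_compl.2 (hcover.trans (union_subset_union huO hvO))
  obtain ⟨C, hC, hCi, hCK⟩ := hJ.exists_isCompact_forall_apply_mem hK hKB
  obtain ⟨E, N, hE, hEi, hEC, hN, hbN, hNE⟩ := exists_isPreconnected_end hP hC hCi
  -- the image of the end under the page of angle `0`
  set F : Set M := (fun q => J (q, 0)) '' E with hF
  have hFc : IsPreconnected F := by
    refine hE.image _ ((hJ.continuousOn.comp (Continuous.prodMk_left (0 : ℝ)).continuousOn ?_).mono hEi)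
    exact fun q hq => ⟨hq, mem_univ _⟩
  have hFO : F ⊆ O₁ ∪ O₂ := by
    rintro _ ⟨q, hq, rfl⟩
    by_contra h
    exact hEC.le_bot ⟨hq, hCK q (hEi hq) 0 h⟩
  -- every binding point is approached by `F` inside any open set around it
  have key : ∀ y ∈ ob.binding, ∀ O : Set M, IsOpen O → y ∈ O → ∃ q ∈ E, J (q, 0) ∈ O := by
    intro y hy O hOo hyO
    obtain ⟨i, x, rfl⟩ := (ob.mem_binding_iff y).1 hy
    have hNc : IsCompact Nᶜ := hN.isClosed_compl.isCompact
    have hNi : Nᶜ ⊆ (𝓡∂ 2).interior P := by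
      rw [← ModelWithCorners.compl_boundary]; exact compl_subset_compl.2 hbN
    have h1 := hJ.eventually_forall_apply_eq_tube_notMem hNc hNi i x
    have h2 := (tendsto_tube_smul (ob := ob) i x).eventually_mem (hOo.mem_nhds hyO)
    have h3 : ∀ᶠ r : ℝ in 𝓝[>] 0, 0 < r := self_mem_nhdsWithin
    obtain ⟨r, ⟨hr1, hr2⟩, hr3⟩ :=
      (((h1.and h2).filter_mono nhdsWithin_le_nhds).and h3).exists
    obtain ⟨q, hq, hqr⟩ := hJ.exists_apply_zero_eq_tube i x hr3
    have hqN : q ∈ N := by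
      by_contra hqN
      exact hr1 q hq 0 hqr hqN
    exact ⟨q, hNE ⟨hqN, hq⟩, hqr ▸ hr2⟩
  -- conclude from the connectedness of `F`
  rcases hFc.subset_or_subset hO₁ hO₂ hO hFO with hF₁ | hF₂
  · left
    intro y hy
    rcases hcover hy with hyu | hyv
    · exact hyu
    · obtain ⟨q, hq, hqO⟩ := key y hy O₂ hO₂ (hvO hyv)
      exact absurd (hO.le_bot ⟨hF₁ ⟨q, hq, rfl⟩, hqO⟩) (notMem_empty _)
  · right
    intro y hy
    rcases hcover hy with hyu | hyv
    · obtain ⟨q, hq, hqO⟩ := key y hy O₁ hO₁ (huO hyu)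
      exact absurd (hO.le_bot ⟨hqO, hF₂ ⟨q, hq, rfl⟩⟩) (notMem_empty _)
    · exact hyv

end IsPageSystem

omit [ChartedSpace (EuclideanHalfSpace 2) P] [TopologicalSpace P] in
/-- **A connected binding is a single circle, the core of any of its tubes**: each core
`range (ob.core i) = B ∩ range (ob.tube i)` is open in `B` (the tube has open range and meets `B`
exactly in its core) and closed (compact), hence all of `B` when `B` is connected. [folklore] -/
theorem _root_.Literature.Geometry.Symplectic.OpenBook.binding_eq_range_core_of_isPreconnected
    [T2Space M] (ob : Literature.Geometry.Symplectic.OpenBook M) (h : IsPreconnected ob.binding)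
    (i : Fin ob.k) : ob.binding = range (ob.core i) := by
  have hcl : IsClosed (range (ob.core i)) := (isCompact_range (ob.continuous_core i)).isClosed
  have hsub : range (ob.core i) ⊆ ob.binding := by
    rintro _ ⟨x, rfl⟩; exact ob.core_mem_binding i x
  refine Subset.antisymm ?_ hsub
  have hcov : ob.binding ⊆ range (ob.tube i) ∪ (range (ob.core i))ᶜ := by
    intro y _
    by_cases hy : y ∈ range (ob.core i)
    · obtain ⟨x, rfl⟩ := hy
      exact Or.inl ⟨(x, 0), rfl⟩
    · exact Or.inr hy
  have hne : (ob.binding ∩ range (ob.tube i)).Nonempty :=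
    ⟨ob.core i (circlePt 0), ob.core_mem_binding i _, (circlePt 0, 0), rfl⟩
  by_contra hnot
  obtain ⟨y, hyB, hyv⟩ : (ob.binding ∩ (range (ob.core i))ᶜ).Nonempty := by
    by_contra h'
    exact hnot fun y hy => by_contra fun hy' => h' ⟨y, hy, hy'⟩
  obtain ⟨z, hzB, ⟨⟨x, w⟩, rfl⟩, hzv⟩ :=
    h _ _ (ob.isOpen_range_tube i) hcl.isOpen_compl hcov hne ⟨y, hyB, hyv⟩
  have hw : w = 0 := (ob.tube_mem_binding_iff i x w).1 hzB
  subst hw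
  exact hzv ⟨x, rfl⟩

end PageSystem

end Literature.Topology.FourManifolds
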